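import Literature.NumberTheory.Automorphic.SmoothRepresentationProofs
import Literature.NumberTheory.Automorphic.SmoothRepresentationCentralCharacterProofs
import Mathlib.Topology.Algebra.ClopenNhdofOne
import Mathlib.LinearAlgebra.Dual.Lemmas
import HarnessLib

/-!
# Discharged fact: the contragredient of an irreducible admissible representation is irreducible

`Literature.NumberTheory.Automorphic.SmoothRepresentation` records as a named fact
(`Representation.isIrreducible_contragredient ρ : Prop`) that for an irreducible admissible
representation `ρ` of a locally profinite group `G`
(`[NonarchimedeanGroup G] [LocallyCompactSpace G] [T2Space G]`) on a vector space `V` over a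
field `k` of characteristic zero, the smooth contragredient `ρ.contragredientRep` (the smooth
part `Ṽ` of the algebraic dual) is irreducible. This file proves it
(`Representation.isIrreducible_contragredient_holds`), so a user holding
`(h : ρ.isIrreducible_contragredient)` can discharge the hypothesis with
`Representation.isIrreducible_contragredient_holds ρ`. On the way it supplies the **projector
onto the `K`-fixed vectors** (`π(ε_K) = ∫_K ρ(g) dg` of the printed sources, built here from
finite averages, without Haar measure) and its first consequence, that smooth linear forms
separate points. Proof sketches are in the docstrings of the two main theorems.

## Main results

* `Representation.sum_quotient_out_apply_mem_fixedPoints` and its neighbours: algebra of the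
  finite averages `∑_{q ∈ K/N} ρ(q̃) u` over a normal subgroup `N ≤ K` of finite index fixing `u`.
* `Representation.IsSmooth.exists_openNormalSubgroup_forall_apply_eq`: in a smooth
  representation every vector is fixed by an open normal subgroup of a given compact `K`.
* `Representation.IsSmooth.exists_fixedPoints_projection`: for `ρ` smooth over a field of
  characteristic zero and `K` with compact carrier, a `K`-invariant `k`-linear projector
  `e : V → V^K` (`e = id` on `V^K`, `e ∘ ρ g = e` for `g ∈ K`).
* `Representation.IsSmooth.exists_mem_contragredient_apply_ne_zero`: smooth linear forms
  separate points (`G` locally compact nonarchimedean, `char k = 0`); so `Ṽ ≠ 0` if `V ≠ 0`.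
* `Representation.IsSmooth.exists_mem_contragredient_apply_ne_zero_of_mem_fixedPoints`: the same
  for a `K`-fixed vector and a given subgroup `K` with compact open carrier, over any
  topological group (the form used for `GL_n(F) ⊇ GL_n(𝒪)`).
* `Representation.isIrreducible_contragredient_holds`: the discharge.

## References

* I. N. Bernstein, A. V. Zelevinsky, *Representations of the group `GL(n, F)` where `F` is a
  non-archimedean local field*, Russian Math. Surveys 31:3 (1976), 1–68, §2 (2.13–2.15).
  doi:10.1070/RM1976v031n03ABEH001532 [BernsteinZelevinskyRMS1976] (not held at the time of
  writing; numbering as recorded on the vendored fact).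
* D. Bump, *Automorphic Forms and Representations*, Cambridge Stud. Adv. Math. 55 (1997), §4.2:
  Proposition 4.2.1 (p. 423), the idempotents `ε_{K₀}` and the contragredient (pp. 425–429,
  Proposition 4.2.5), Exercise 4.2.8 (p. 434: "the contragredient of an irreducible admissible
  representation of `GL(n, F)` is irreducible", used as Proposition 4.2.8 on p. 492). Page
  numbers are those of the held PDF. [Bump1997]
* C. J. Bushnell, G. Henniart, *The local Langlands conjecture for `GL(2)`* (2006), §§2.8–2.10.
-/

namespace Representation


section Averaging

variable {k G V : Type*} [CommRing k] [Group G] [AddCommGroup V] [Module k V]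
  (ρ : Representation k G V)

/-- If a subgroup `N ≤ K` fixes `u`, then `ρ a u` only depends on the coset `a N` (`a ∈ K`).
[folklore] -/
theorem apply_eq_apply_of_quotient_eq {K : Subgroup G} (N : Subgroup K) {u : V}
    (hu : ∀ n ∈ N, ρ ((n : K) : G) u = u) {a b : K} (h : (a : K ⧸ N) = b) :
    ρ (a : G) u = ρ (b : G) u := by
  have hab : ρ (((a⁻¹ * b : K) : K) : G) u = u := hu _ (QuotientGroup.eq.1 h)
  rw [Subgroup.coe_mul, Subgroup.coe_inv, map_mul, Module.End.mul_apply] at hab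
  calc ρ (a : G) u = ρ (a : G) (ρ (a : G)⁻¹ (ρ (b : G) u)) := by rw [hab]
    _ = ρ (b : G) u := by
      rw [← Module.End.mul_apply, ← map_mul, mul_inv_cancel, map_one, Module.End.one_apply]

/-- For a normal subgroup `N ≤ K` of finite index fixing `u`, the average
`∑_{q ∈ K/N} ρ(q̃) u` over coset representatives is a `K`-fixed vector: left multiplication by
`g ∈ K` permutes `K/N`. [folklore] -/
theorem sum_quotient_out_apply_mem_fixedPoints {K : Subgroup G} (N : Subgroup K) [N.Normal]
    [Fintype (K ⧸ N)] {u : V} (hu : ∀ n ∈ N, ρ ((n : K) : G) u = u) :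
    (∑ q : K ⧸ N, ρ ((q.out : K) : G) u) ∈ ρ.fixedPoints K := by
  rw [mem_fixedPoints]
  intro g hg
  rw [map_sum]
  refine Fintype.sum_equiv (Equiv.mulLeft (((⟨g, hg⟩ : K) : K ⧸ N))) _ _ fun q => ?_
  rw [Equiv.coe_mulLeft, ← Module.End.mul_apply, ← map_mul]
  have hcoe : g * ((q.out : K) : G) = (((⟨g, hg⟩ : K) * q.out : K) : G) := rfl
  rw [hcoe]
  refine ρ.apply_eq_apply_of_quotient_eq N hu ?_
  rw [QuotientGroup.mk_mul, QuotientGroup.out_eq', QuotientGroup.out_eq']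

/-- For a normal subgroup `N ≤ K` of finite index fixing `u` and `g ∈ K`, the averages of
`ρ g u` and of `u` over `K/N` agree: right multiplication by `g N` permutes `K/N`. [folklore] -/
theorem sum_quotient_out_apply_apply {K : Subgroup G} (N : Subgroup K) [N.Normal]
    [Fintype (K ⧸ N)] {u : V} (hu : ∀ n ∈ N, ρ ((n : K) : G) u = u) {g : G} (hg : g ∈ K) :
    (∑ q : K ⧸ N, ρ ((q.out : K) : G) (ρ g u)) = ∑ q : K ⧸ N, ρ ((q.out : K) : G) u := by
  refine Fintype.sum_equiv (Equiv.mulRight (((⟨g, hg⟩ : K) : K ⧸ N))) _ _ fun q => ?_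
  rw [Equiv.coe_mulRight, ← Module.End.mul_apply, ← map_mul]
  have hcoe : ((q.out : K) : G) * g = ((q.out * ⟨g, hg⟩ : K) : G) := rfl
  rw [hcoe]
  refine ρ.apply_eq_apply_of_quotient_eq N hu ?_
  rw [QuotientGroup.mk_mul, QuotientGroup.out_eq', QuotientGroup.out_eq']

/-- On `K`-fixed vectors the average over `K/N` is multiplication by `[K : N]`. [folklore] -/
theorem sum_quotient_out_apply_of_mem_fixedPoints {K : Subgroup G} (N : Subgroup K)
    [Fintype (K ⧸ N)] {u : V} (hu : u ∈ ρ.fixedPoints K) :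
    (∑ q : K ⧸ N, ρ ((q.out : K) : G) u) = Fintype.card (K ⧸ N) • u := by
  rw [mem_fixedPoints] at hu
  rw [← Finset.card_univ, ← Finset.sum_const]
  exact Finset.sum_congr rfl fun q _ => hu _ (q.out).2

/-- **Independence of the averaging subgroup.** If two normal subgroups `N, N' ≤ K` of finite
index both fix `u`, then `[K : N'] • ∑_{K/N} ρ(q̃) u = [K : N] • ∑_{K/N'} ρ(q̃') u` (the normalised
averages agree). No fibre counting: average the `K`-fixed vector `w = ∑_{K/N} ρ(q̃) u` over `K/N'`
to get `[K : N'] • w`, and expand `w` using the `K`-invariance of the `K/N'`-average. [folklore] -/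
theorem card_smul_sum_quotient_out_apply_comm {K : Subgroup G} (N N' : Subgroup K) [N.Normal]
    [N'.Normal] [Fintype (K ⧸ N)] [Fintype (K ⧸ N')] {u : V}
    (hu : ∀ n ∈ N, ρ ((n : K) : G) u = u) (hu' : ∀ n ∈ N', ρ ((n : K) : G) u = u) :
    Fintype.card (K ⧸ N') • (∑ q : K ⧸ N, ρ ((q.out : K) : G) u) =
      Fintype.card (K ⧸ N) • ∑ q' : K ⧸ N', ρ ((q'.out : K) : G) u := by
  have hw := ρ.sum_quotient_out_apply_mem_fixedPoints N hu
  rw [← ρ.sum_quotient_out_apply_of_mem_fixedPoints N' hw]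
  simp_rw [map_sum]
  rw [Finset.sum_comm]
  rw [Finset.sum_congr rfl fun q _ => ρ.sum_quotient_out_apply_apply N' hu' (q.out).2,
    Finset.sum_const, Finset.card_univ]

variable [TopologicalSpace G] [IsTopologicalGroup G]

/-- In a smooth representation, every vector `u` is fixed by an open *normal* subgroup of any
compact subgroup `K ≤ G`: the open subgroup `K ∩ Stab(u)` of the compact group `K` contains an
open normal subgroup (Mathlib `IsTopologicalGroup.exist_openNormalSubgroup_sub_clopen_nhds_of_one`,
a normal core). (Cf. Bump 1997, Proposition 4.2.1, p. 423.) [folklore] -/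
theorem IsSmooth.exists_openNormalSubgroup_forall_apply_eq {ρ : Representation k G V}
    (hρ : ρ.IsSmooth) (K : Subgroup G) [CompactSpace K] (u : V) :
    ∃ N : OpenNormalSubgroup K, ∀ n ∈ N, ρ ((n : K) : G) u = u := by
  have hopen : IsOpen (((ρ.stabilizerSubgroup u).subgroupOf K : Subgroup K) : Set K) :=
    Subgroup.subgroupOf_isOpen K _ (hρ u)
  obtain ⟨N, hN⟩ := IsTopologicalGroup.exist_openNormalSubgroup_sub_clopen_nhds_of_one
    ⟨Subgroup.isClosed_of_isOpen _ hopen, hopen⟩ (Subgroup.one_mem _)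
  exact ⟨N, fun n hn => Subgroup.mem_subgroupOf.1 (hN hn)⟩

end Averaging


section Projector

variable {k G V : Type*} [Field k] [CharZero k] [Group G] [TopologicalSpace G]
  [IsTopologicalGroup G] [AddCommGroup V] [Module k V]

/-- **The projector `e_K`.** Let `ρ` be a smooth representation over a field of characteristic
zero and `K ≤ G` a subgroup with compact carrier. There is a `k`-linear map `e : V → V` with
values in `V^K`, restricting to the identity on `V^K`, and `K`-invariant (`e (ρ g v) = e v` for
`g ∈ K`); in the printed sources this is `π(ε_K) v = ∫_K ρ(g) v dg` for the normalised Haar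
measure of `K`. Construction without measure theory: `e v = [K : N]⁻¹ • ∑_{q ∈ K/N} ρ(q̃) v` for
any open normal subgroup `N ≤ K` fixing `v` (`IsSmooth.exists_openNormalSubgroup_forall_apply_eq`),
which is independent of `N` by `card_smul_sum_quotient_out_apply_comm`; linearity follows by
passing to a common such `N`. (Bump 1997, §4.2, pp. 425–429, the idempotents `ε_{K₀}`;
Bernstein–Zelevinsky 1976, §2.) [folklore] -/
theorem IsSmooth.exists_fixedPoints_projection {ρ : Representation k G V} (hρ : ρ.IsSmooth)
    {K : Subgroup G} (hKc : IsCompact (K : Set G)) :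
    ∃ e : V →ₗ[k] V, (∀ v, e v ∈ ρ.fixedPoints K) ∧ (∀ v ∈ ρ.fixedPoints K, e v = v) ∧
      ∀ g ∈ K, ∀ v, e (ρ g v) = e v := by
  haveI : CompactSpace K := isCompact_iff_compactSpace.mp hKc
  -- an open normal subgroup of `K` fixing each vector, and the finiteness of the quotients
  choose N hN using fun v : V => hρ.exists_openNormalSubgroup_forall_apply_eq K v
  have fin : ∀ M : OpenNormalSubgroup K, Fintype (K ⧸ M.toSubgroup) := fun M => Fintype.ofFinite _
  -- the normalised averaging operators
  let A : OpenNormalSubgroup K → (V →ₗ[k] V) := fun M =>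
    ((Fintype.card (K ⧸ M.toSubgroup) : k)⁻¹) • ∑ q : K ⧸ M.toSubgroup, ρ ((q.out : K) : G)
  have hA : ∀ (M : OpenNormalSubgroup K) (v : V), A M v =
      ((Fintype.card (K ⧸ M.toSubgroup) : k)⁻¹) •
        ∑ q : K ⧸ M.toSubgroup, ρ ((q.out : K) : G) v := by
    intro M v
    simp only [A, LinearMap.smul_apply, LinearMap.coe_sum, Finset.sum_apply]
  have hcard : ∀ M : OpenNormalSubgroup K, (Fintype.card (K ⧸ M.toSubgroup) : k) ≠ 0 :=
    fun M => Nat.cast_ne_zero.2 Fintype.card_ne_zero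
  -- independence of the normal subgroup
  have hindep : ∀ (M M' : OpenNormalSubgroup K) (v : V), (∀ n ∈ M, ρ ((n : K) : G) v = v) →
      (∀ n ∈ M', ρ ((n : K) : G) v = v) → A M v = A M' v := by
    intro M M' v hM hM'
    rw [hA, hA]
    have h := ρ.card_smul_sum_quotient_out_apply_comm M.toSubgroup M'.toSubgroup hM hM'
    rw [← Nat.cast_smul_eq_nsmul k, ← Nat.cast_smul_eq_nsmul k] at h
    rw [← inv_smul_smul₀ (hcard M') (∑ q : K ⧸ M.toSubgroup, ρ ((q.out : K) : G) v), h,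
      smul_comm _⁻¹ _⁻¹, inv_smul_smul₀ (hcard M)]
  have hle₁ (M M' : OpenNormalSubgroup K) {n : K} (hn : n ∈ M ⊓ M') : n ∈ M := inf_le_left (b := M') hn
  have hle₂ (M M' : OpenNormalSubgroup K) {n : K} (hn : n ∈ M ⊓ M') : n ∈ M' := inf_le_right (a := M) hn
  -- the projector, as a function, and its agreement with every admissible average
  have he : ∀ (M : OpenNormalSubgroup K) (v : V), (∀ n ∈ M, ρ ((n : K) : G) v = v) →
      A (N v) v = A M v := fun M v hM => hindep _ _ v (hN v) hM
  refine ⟨{ toFun := fun v => A (N v) v, map_add' := fun u u' => ?_, map_smul' := fun c u => ?_ },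
    fun v => ?_, fun v hv => ?_, fun g hg v => ?_⟩
  · -- additivity: pass to `N u ⊓ N u'`
    have hu : ∀ n ∈ N u ⊓ N u', ρ ((n : K) : G) u = u := fun n hn => hN u n (hle₁ _ _ hn)
    have hu' : ∀ n ∈ N u ⊓ N u', ρ ((n : K) : G) u' = u' := fun n hn => hN u' n (hle₂ _ _ hn)
    have huu' : ∀ n ∈ N u ⊓ N u', ρ ((n : K) : G) (u + u') = u + u' := fun n hn => by
      rw [map_add, hu n hn, hu' n hn]
    rw [he _ _ huu', he _ _ hu, he _ _ hu', map_add]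
  · -- homogeneity
    have hcu : ∀ n ∈ N u, ρ ((n : K) : G) (c • u) = c • u := fun n hn => by
      rw [map_smul, hN u n hn]
    simp only [RingHom.id_apply]
    rw [he _ _ hcu, map_smul]
  · -- values in `V^K`
    change A (N v) v ∈ ρ.fixedPoints K
    rw [hA]
    exact Submodule.smul_mem _ _ (ρ.sum_quotient_out_apply_mem_fixedPoints _ (hN v))
  · -- identity on `V^K`
    change A (N v) v = v
    rw [hA, ρ.sum_quotient_out_apply_of_mem_fixedPoints _ hv, ← Nat.cast_smul_eq_nsmul k,
      inv_smul_smul₀ (hcard _)]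
  · -- `K`-invariance: pass to `N v ⊓ N (ρ g v)`
    change A (N (ρ g v)) (ρ g v) = A (N v) v
    have hv : ∀ n ∈ N v ⊓ N (ρ g v), ρ ((n : K) : G) v = v := fun n hn => hN v n (hle₁ _ _ hn)
    have hgv : ∀ n ∈ N v ⊓ N (ρ g v), ρ ((n : K) : G) (ρ g v) = ρ g v :=
      fun n hn => hN (ρ g v) n (hle₂ _ _ hn)
    rw [he _ _ hgv, he _ _ hv, hA, hA, ρ.sum_quotient_out_apply_apply _ hv hg]

end Projector



section Separation

variable {k G V : Type*} [Field k] [CharZero k] [Group G] [TopologicalSpace G]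
  [AddCommGroup V] [Module k V]

open Literature.NumberTheory.Automorphic in
/-- **Smooth linear forms separate points.** If `ρ` is a smooth representation of a locally
compact nonarchimedean group over a field of characteristic zero and `v ≠ 0`, there is a smooth
linear form `f ∈ Ṽ` (the contragredient) with `f v ≠ 0`: take a compact open `K` fixing `v`
(`exists_isCompact_openSubgroup` intersected with the open stabiliser of `v`), any linear form
`l` with `l v ≠ 0`, and `f = l ∘ e_K` with `e_K` the `K`-invariant projector of
`IsSmooth.exists_fixedPoints_projection`; then `f` is `K`-invariant, hence smooth, and
`f v = l v`. In particular the contragredient of a non-zero smooth representation is non-zero.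
(Bump 1997, proof of Proposition 4.2.5, p. 429: `v̂ = π̂(ε_{K₀}) v̂₁`; Bernstein–Zelevinsky 1976,
§2.) [folklore] -/
theorem IsSmooth.exists_mem_contragredient_apply_ne_zero [NonarchimedeanGroup G]
    [LocallyCompactSpace G] {ρ : Representation k G V} (hρ : ρ.IsSmooth) {v : V} (hv : v ≠ 0) :
    ∃ f ∈ ρ.contragredient, f v ≠ 0 := by
  obtain ⟨K₀, hK₀c⟩ := exists_isCompact_openSubgroup (G := G)
  set K : Subgroup G := (K₀ : Subgroup G) ⊓ ρ.stabilizerSubgroup v with hKdef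
  have hKo : IsOpen (K : Set G) := K₀.isOpen.inter (hρ v)
  have hKc : IsCompact (K : Set G) :=
    hK₀c.of_isClosed_subset (Subgroup.isClosed_of_isOpen _ hKo) fun g hg => hg.1
  have hvK : v ∈ ρ.fixedPoints K := (ρ.mem_fixedPoints K v).2 fun g hg => hg.2
  obtain ⟨e, -, he₂, he₃⟩ := hρ.exists_fixedPoints_projection hKc
  obtain ⟨l, hl⟩ := Module.Projective.exists_dual_ne_zero k hv
  refine ⟨l ∘ₗ e, ?_, ?_⟩
  · refine ρ.dual.isSmoothVector_of_le hKo fun g hg => ?_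
    rw [mem_stabilizerSubgroup]
    ext x
    simp only [dual_apply, Module.Dual.transpose_apply, LinearMap.comp_apply]
    rw [he₃ _ (K.inv_mem hg)]
  · rwa [LinearMap.comp_apply, he₂ v hvK]

/-- **Smooth linear forms separate `K`-fixed vectors, for any topological group.** If `ρ` is a
smooth representation of a topological group `G` over a field of characteristic zero, `K ≤ G` is
a subgroup with open and compact carrier, and `0 ≠ v ∈ V^K`, there is a `K`-invariant — hence
smooth — linear form `f ∈ Ṽ` with `f v ≠ 0`, namely `f = l ∘ e_K` for any linear form `l` with
`l v ≠ 0` and the projector `e_K` of `IsSmooth.exists_fixedPoints_projection`. Unlike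
`IsSmooth.exists_mem_contragredient_apply_ne_zero` this asks for no compact open subgroup of `G`
beyond the given `K` (no `NonarchimedeanGroup`/`LocallyCompactSpace` instances), which is the
form needed for `GL_n(F) ⊇ GL_n(𝒪)` (`glInt`, `isOpen_glInt`, `isCompact_glInt`), where those
instances are not available. (Bump 1997, proof of Proposition 4.2.5, p. 429; Bernstein–Zelevinsky
1976, §2.) [folklore] -/
theorem IsSmooth.exists_mem_contragredient_apply_ne_zero_of_mem_fixedPoints [IsTopologicalGroup G]
    {ρ : Representation k G V} (hρ : ρ.IsSmooth) {K : Subgroup G} (hKo : IsOpen (K : Set G))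
    (hKc : IsCompact (K : Set G)) {v : V} (hv : v ∈ ρ.fixedPoints K) (hv0 : v ≠ 0) :
    ∃ f ∈ ρ.contragredient, (∀ g ∈ K, ρ.dual g f = f) ∧ f v ≠ 0 := by
  obtain ⟨e, -, he₂, he₃⟩ := hρ.exists_fixedPoints_projection hKc
  obtain ⟨l, hl⟩ := Module.Projective.exists_dual_ne_zero k hv0
  have hinv : ∀ g ∈ K, ρ.dual g (l ∘ₗ e) = l ∘ₗ e := fun g hg => by
    ext x
    simp only [dual_apply, Module.Dual.transpose_apply, LinearMap.comp_apply]
    rw [he₃ _ (K.inv_mem hg)]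
  refine ⟨l ∘ₗ e, ?_, hinv, ?_⟩
  · exact ρ.dual.isSmoothVector_of_le hKo fun g hg => by
      rw [mem_stabilizerSubgroup]
      exact hinv g hg
  · rwa [LinearMap.comp_apply, he₂ v hv]

end Separation


section Irreducible

variable {k G V : Type*} [Field k] [Group G] [TopologicalSpace G] [AddCommGroup V] [Module k V]

open Literature.NumberTheory.Automorphic in
/-- **Discharge of `Representation.isIrreducible_contragredient`**: the contragredient `Ṽ` of an
irreducible admissible representation `V` of a locally profinite group over a field of
characteristic zero is irreducible.

Proof. `Ṽ ≠ 0` by `IsSmooth.exists_mem_contragredient_apply_ne_zero`. Let `W ≤ Ṽ` be a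
subrepresentation with `W ≠ Ṽ` and pick `f ∈ Ṽ ∖ W`; let `K` be a compact open subgroup fixing
`f` (a compact open subgroup intersected with the open stabiliser of `f`). The restriction
`R : Ṽ^K → (V^K)^*` is injective (`IsSmooth.dual_eq_zero_of_forall_mem_fixedPoints`), so
`R f ∉ R(W^K) =: L`; as `V^K` is finite-dimensional (admissibility), finite-dimensional duality
(`Subspace.dualCoannihilator_dualAnnihilator_eq`) yields `v ∈ V^K` annihilated by `L` with
`f v ≠ 0`. Every `w ∈ W` vanishes at `v`: the `K`-orbit `S` of `w` in `Ṽ` is finite,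
`∑_{x ∈ S} x ∈ W^K` vanishes at `v`, and `∑_{x ∈ S} x(v) = |S| · w(v)` because `v` is `K`-fixed.
Hence the joint kernel `{x | ∀ w ∈ W, w x = 0}` is a subrepresentation of `V` containing
`v ≠ 0`, so it is all of `V` by irreducibility, i.e. `W = 0`.
(Bernstein–Zelevinsky 1976, Proposition 2.15, numbering as recorded on the vendored fact;
Bushnell–Henniart §2.10; Bump 1997, Exercise 4.2.8, p. 434, stated for `GL(n, F)` and used as
"Proposition 4.2.8" on p. 492.) [cite: Bump1997, Exercise 4.2.8, p. 434] -/
theorem isIrreducible_contragredient_holds (ρ : Representation k G V) :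
    ρ.isIrreducible_contragredient := by
  intro _ _ _ _ _ hρ
  -- `Ṽ ≠ 0`
  haveI : Nontrivial V := IsIrreducible.nontrivial ρ
  obtain ⟨v₁, hv₁⟩ := exists_ne (0 : V)
  obtain ⟨f₁, hf₁, hf₁v⟩ := hρ.1.exists_mem_contragredient_apply_ne_zero hv₁
  let F₁ : ρ.Contragredient := ⟨f₁, hf₁⟩
  have hF₁ : Contragredient.subtype ρ F₁ = f₁ := rfl
  have hbt : (⊥ : Subrepresentation ρ.contragredientRep) ≠ ⊤ := by
    intro h
    have hmem : F₁ ∈ (⊤ : Subrepresentation ρ.contragredientRep) := Subrepresentation.mem_top' _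
    rw [← h, Subrepresentation.mem_bot_iff] at hmem
    apply hf₁v
    rw [← hF₁, hmem, map_zero, LinearMap.zero_apply]
  haveI : Nontrivial (Subrepresentation ρ.contragredientRep) := ⟨⟨⊥, ⊤, hbt⟩⟩
  refine ⟨fun W => ?_⟩
  refine or_iff_not_imp_right.2 fun hW => ?_
  -- a smooth form outside `W`, and a compact open subgroup `K` fixing it
  obtain ⟨f, hfW⟩ : ∃ f : ρ.Contragredient, f ∉ W := by
    by_contra h
    push Not at h
    exact hW (Subrepresentation.toSubmodule_injective (Submodule.eq_top_iff'.2 h))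
  obtain ⟨K₀, hK₀c⟩ := exists_isCompact_openSubgroup (G := G)
  have hfs : ρ.dual.IsSmoothVector (Contragredient.subtype ρ f) := f.2
  set K : Subgroup G := (K₀ : Subgroup G) ⊓ ρ.dual.stabilizerSubgroup (Contragredient.subtype ρ f)
    with hKdef
  have hKo : IsOpen (K : Set G) := K₀.isOpen.inter hfs
  have hKc : IsCompact (K : Set G) :=
    hK₀c.of_isClosed_subset (Subgroup.isClosed_of_isOpen _ hKo) fun g hg => hg.1
  haveI : Module.Finite k (ρ.fixedPoints K) := hρ.2 ⟨K, hKo⟩ hKc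
  have hfK : f ∈ ρ.contragredientRep.fixedPoints K := by
    rw [mem_fixedPoints]
    intro g hg
    apply Contragredient.subtype_injective ρ
    rw [subtype_contragredientRep_apply]
    exact hg.2
  -- the restriction map `V^* → (V^K)^*` and the image `L` of `W^K`
  let R : Module.Dual k V →ₗ[k] Module.Dual k (ρ.fixedPoints K) := (ρ.fixedPoints K).subtype.dualMap
  let WK : Submodule k ρ.Contragredient :=
    W.toSubmodule ⊓ ρ.contragredientRep.fixedPoints K
  let L : Submodule k (Module.Dual k (ρ.fixedPoints K)) := WK.map (R ∘ₗ Contragredient.subtype ρ)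
  -- `R f ∉ L`, by injectivity of `Ṽ^K → (V^K)^*`
  have hRf : R (Contragredient.subtype ρ f) ∉ L := by
    rintro ⟨w, ⟨hwW, hwK⟩, hw⟩
    have hψ : Contragredient.subtype ρ (f - w) = 0 := by
      refine hρ.1.dual_eq_zero_of_forall_mem_fixedPoints hKc _ (fun g hg x => ?_) (fun x hx => ?_)
      · have h1 := (ρ.contragredientRep.mem_fixedPoints K (f - w)).1 (sub_mem hfK hwK) g⁻¹
          (K.inv_mem hg)
        have h2 := LinearMap.congr_fun (congrArg (Contragredient.subtype ρ) h1) x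
        rw [subtype_contragredientRep_apply] at h2
        simpa only [dual_apply, inv_inv, Module.Dual.transpose_apply, LinearMap.comp_apply] using h2
      · have hx' := LinearMap.congr_fun hw ⟨x, hx⟩
        simp only [R, LinearMap.comp_apply, LinearMap.dualMap_apply, Submodule.subtype_apply] at hx'
        rw [map_sub, LinearMap.sub_apply, hx', sub_self]
    have hfw : f = w := by
      rw [← sub_eq_zero]
      exact Contragredient.subtype_injective ρ (by rw [hψ, map_zero])
    exact hfW (hfw ▸ hwW)
  -- finite-dimensional duality: a `K`-fixed vector `v` killed by `L` with `f v ≠ 0`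
  obtain ⟨u, huL, hu⟩ : ∃ u ∈ L.dualCoannihilator, R (Contragredient.subtype ρ f) u ≠ 0 := by
    by_contra h
    push Not at h
    have hmem := (Submodule.mem_dualAnnihilator _).2 h
    rw [Subspace.dualCoannihilator_dualAnnihilator_eq] at hmem
    exact hRf hmem
  have hvK : (u : V) ∈ ρ.fixedPoints K := u.2
  have hfv : Contragredient.subtype ρ f (u : V) ≠ 0 := by
    simpa only [R, LinearMap.dualMap_apply, Submodule.subtype_apply] using hu
  have hWKv : ∀ w ∈ WK, Contragredient.subtype ρ w (u : V) = 0 := fun w hw => by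
    simpa only [R, LinearMap.comp_apply, LinearMap.dualMap_apply, Submodule.subtype_apply] using
      (Submodule.mem_dualCoannihilator u).1 huL _ (Submodule.mem_map_of_mem hw)
  -- every `w ∈ W` vanishes at `v`: average `w` over its finite `K`-orbit inside `W`
  have hWv : ∀ w ∈ W, Contragredient.subtype ρ w (u : V) = 0 := by
    intro w hw
    have hfin := ρ.isSmooth_contragredientRep.finite_image_apply hKc w
    have hw'K := ρ.contragredientRep.sum_mem_fixedPoints_of_finite_orbit K w hfin
    have hw'W : (∑ x ∈ hfin.toFinset, x) ∈ W.toSubmodule :=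
      Submodule.sum_mem _ fun x hx => by
        obtain ⟨g, -, rfl⟩ := (Set.Finite.mem_toFinset hfin).1 hx
        exact W.apply_mem_toSubmodule g hw
    have h0 := hWKv _ ⟨hw'W, hw'K⟩
    have hsum : Contragredient.subtype ρ (∑ x ∈ hfin.toFinset, x) (u : V) =
        hfin.toFinset.card • Contragredient.subtype ρ w (u : V) := by
      rw [map_sum, LinearMap.sum_apply, ← Finset.sum_const]
      refine Finset.sum_congr rfl fun x hx => ?_
      obtain ⟨g, hg, rfl⟩ := (Set.Finite.mem_toFinset hfin).1 hx
      rw [subtype_contragredientRep_apply]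
      simp only [dual_apply, Module.Dual.transpose_apply, LinearMap.comp_apply]
      rw [(ρ.mem_fixedPoints K _).1 hvK g⁻¹ (K.inv_mem hg)]
    have hmem : w ∈ hfin.toFinset := (Set.Finite.mem_toFinset hfin).2 ⟨1, K.one_mem, by simp⟩
    have hcard : (hfin.toFinset.card : k) ≠ 0 := Nat.cast_ne_zero.2 (Finset.card_ne_zero_of_mem hmem)
    rw [hsum, nsmul_eq_mul] at h0
    exact (mul_eq_zero.1 h0).resolve_left hcard
  -- the joint kernel of `W` is a non-zero subrepresentation of `V`, hence everything
  let P : Subrepresentation ρ :=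
    ⟨{ carrier := {x | ∀ w ∈ W, Contragredient.subtype ρ w x = 0}
       add_mem' := fun {x y} hx hy w hw => by
         rw [map_add, hx w hw, hy w hw, add_zero]
       zero_mem' := fun w _ => map_zero _
       smul_mem' := fun c x hx w hw => by
         rw [map_smul, hx w hw, smul_zero] },
     fun g x hx w hw => by
       have h := hx _ (W.apply_mem_toSubmodule g⁻¹ hw)
       rw [subtype_contragredientRep_apply] at h
       simpa only [dual_apply, inv_inv, Module.Dual.transpose_apply, LinearMap.comp_apply] using h⟩
  have hPv : (u : V) ∈ P := hWv
  have hP : P = ⊤ := (eq_bot_or_eq_top P).resolve_left fun h => by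
    have h' : (u : V) ∈ (⊥ : Subrepresentation ρ) := h ▸ hPv
    rw [Subrepresentation.mem_bot_iff] at h'
    exact hfv (by rw [h', map_zero])
  -- conclude `W = ⊥`
  rw [eq_bot_iff]
  intro w hw
  rw [Subrepresentation.mem_bot_iff]
  apply Contragredient.subtype_injective ρ
  rw [map_zero]
  ext x
  have hx : x ∈ P := hP ▸ Subrepresentation.mem_top' x
  exact hx w hw

end Irreducible

end Representation
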